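import Summits.ABC.IUTFork.Repair.RHAxisCK1Requirements
import HarnessLib

/-!
# R-H ROUND 4, R4-3 IDEATION CELL — REFUTER INSTRUMENT (abc-iut-rh4-crit-1): a `q`-factor of automorphy FORCES the square law
# — the value-level κ′-theta requirement `R4_valueLaw k` (p534392) is satisfiable ONLY at the print exponent `k = 4` (`κ′ = 2`)

PROOF-ONLY file (0 definitions, 0 `Prop` facts; abc-iut cell, rung LADDER-ABC:A2.RESCUE.H; seat abc-iut-rh4-crit-1 = R4-3 refuter 1, KEY
`wake/KEY-abc-iut-rh4-crit-1-R4CRIT-1.md`; census ROUND4/OPENINGS-CENSUS.md rows O-01…O-05 (κ₁ doors) / O-3x (ideation cards)).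

WHAT. abc-iut-reqb-typ-1's `R4_valueLaw k q̈ F` (file `RHAxisCK1Requirements`, §2) types the VALUE-LEVEL object a κ′-theory must supply in place of
[EtTh] Prop 1.4: a function `F` on a normed field vanishing on `𝕜^×` exactly at the cusps `±q̈^n` and admitting a factor of automorphy
`F(q̈^n·U) = c_n·U^{w_n}·F(U)` (`n ∈ ℤ`, `U ≠ 0`) whose ORDER LAW is `‖c_n‖ = ‖q̈‖^{−⌈|n|^{k/2}⌉}` (`lawPow k |n|`; print `k = 4`: `c_n = (−1)^n q̈^{−n²}`,
`w_n = −2n`, calibration `R4_valueLaw_four_automorphy_thetaDdot`). THIS FILE proves the folklore COCYCLE OBSTRUCTION behind the lens-1/lens-2 falsifier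
«the valuation of theta values is forced to be quadratic in the label by the `q`-expansion — say exactly which function would not be»:
* `cocycle` — under `R4_valueLaw k q̈ F` with `0 < ‖q̈‖ < 1` and ONE unit `ζ` (`‖ζ‖ = 1`, `ζ ≠ ±1`; then `F ζ ≠ 0` by clause (i′), `F_ne_zero_of_unit`),
  comparing `F(q̈^{n+m}ζ)` computed directly and via `q̈^n·(q̈^m ζ)` gives the integer identity `m·w_n = L(n) + L(m) − L(n+m)` for ALL `n m : ℤ`,
  `L(n) := lawPow k |n|`;
* `lawPow_eq_sq_of_valueLaw` — hence `L(n) = n²·L(1)`-shape: `lawPow k m = m²` for every `m : ℕ` (from `(1,1)`, `(1,−1)`, `(1,m)`: `w_1 = −2`, induction);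
* `eq_four_of_valueLaw` — hence **`k = 4`** (at `m = 2`: `⌈√(2^k)⌉ = 4` iff `k = 4`, for `1 ≤ k`; `k = 0` is excluded by `lawPow 0 0 = 1 ≠ 0`);
* `not_valueLaw_two` / `not_valueLaw_three` / `not_valueLaw_five` — the live κ′ ∈ {1, 3/2} doors' value-level object (and κ′ = 5/2) DOES NOT EXIST on any
  Tate-type uniformisation `𝕜^× / q̈^ℤ` carrying a unit `≠ ±1`: NO meromorphic «κ′-theta function» with a `q̈^ℤ`-factor of automorphy has pilot orders
  `⌈j^{κ′}⌉`, `κ′ ≠ 2`. Two-line witnesses: `κ′ = 1`: `(n,m) = (1,1)` gives `w_1 = 0`, `(1,−1)` gives `w_1 = −2`; `κ′ = 3/2`: `(1,1)` gives `w_1 = −1`, `(1,3)` gives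
  `3·w_1 = 1 + 6 − 8 = −1`.
SCOPE (honest): this kills exactly the objects typed by `R4_valueLaw k` — ONE function with ONE factor of automorphy for the FULL group `q̈^ℤ` evaluated at the
torsion translates `q̈^n·ζ`; it says nothing about objects that change the EVALUATION POINTS, the PACKET dimension, the number of theta functions, or that live
outside a Tate uniformisation (those are other census rows, to be falsified on their own dictionary); `R4_thetaSection k` (the ∀-settings form) inherits the
obstruction at every [EtTh] §1 setting whose `q̈` has norm in `(0,1)` and whose field has a unit `≠ ±1` (every `p`-adic setting, `p` odd or not: `ζ = 1 + q̈`).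
HONEST FRAMING: elementary normed-field algebra about OUR typed requirement; nothing here is a reading of [EtTh] beyond the calibration already in p534392;
nothing asserts abc proved or refuted; no side on [IUTchIII] Cor. 3.12 / [IUTchIV] Thm. 1.10 or on any author (D-0045); typed ≠ proved for every IUT
locution; refuted-as-typed ≠ refuted-in-print. [folklore] (factors of automorphy on `𝔾_m/q^ℤ` have degree·n²/2 growth).
[cite: MochizukiEtTh2009, Prop 1.4 (ii) p.21] [cite: Mochizuki2012, IUTchII Rmk 2.5.1 (i) p.72] [claim: Mochizuki2012, status: disputed]
-/

noncomputable section

namespace Summit.ABC.IUTFork.Repair.RH.AxisCK1ValueLawNoGo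

open Summit.ABC.IUTFork.Repair.RH.ReqsideWeightLaws Summit.ABC.IUTFork.Repair.RH.AxisCK1Requirements

variable {𝕜 : Type*} [NormedField 𝕜] {k : ℕ} {q2 : 𝕜} {F : 𝕜 → 𝕜}

/-- A unit-norm element is non-zero. [folklore] -/
theorem ne_zero_of_norm_eq_one {ζ : 𝕜} (hζ1 : ‖ζ‖ = 1) : ζ ≠ 0 := by
  intro h0
  rw [h0, norm_zero] at hζ1
  exact zero_ne_one hζ1

/-- **Clause (i′) at a unit**: under `R4_valueLaw k q̈ F` with `‖q̈‖ < 1`, `F` does not vanish at any unit `ζ ≠ ±1` (a unit `±q̈^n` has `n = 0`). [folklore] -/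
theorem F_ne_zero_of_unit (h : R4_valueLaw k q2 F) (hq1 : ‖q2‖ < 1) {ζ : 𝕜} (hζ1 : ‖ζ‖ = 1) (hζp : ζ ≠ 1)
    (hζm : ζ ≠ -1) : F ζ ≠ 0 := by
  intro hF
  obtain ⟨n, hn⟩ := (h.1 ζ (ne_zero_of_norm_eq_one hζ1)).mp hF
  have hnorm : ‖q2‖ ^ n = 1 := by
    rw [← norm_zpow]
    rcases hn with hn | hn
    · rw [← hn, hζ1]
    · rw [← norm_neg, ← hn, hζ1]
  have hn0 : n = 0 := (zpow_eq_one_iff_right₀ (norm_nonneg _) hq1.ne).mp hnorm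
  subst hn0
  rw [zpow_zero] at hn
  rcases hn with hn | hn
  exacts [hζp hn, hζm hn]

/-- **THE COCYCLE IDENTITY**: under `R4_valueLaw k q̈ F` (`0 < ‖q̈‖ < 1`, one unit `ζ ≠ ±1`), the factor of automorphy satisfies
`m·w_n = L(n) + L(m) − L(n+m)` for all `n m : ℤ`, `L(n) = lawPow k |n|` — compare `F(q̈^{n+m}·ζ)` with `F(q̈^n·(q̈^m·ζ))` and take norms. [folklore] -/
theorem cocycle (h : R4_valueLaw k q2 F) (hq0 : q2 ≠ 0) (hq1 : ‖q2‖ < 1) {ζ : 𝕜} (hζ1 : ‖ζ‖ = 1) (hζp : ζ ≠ 1)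
    (hζm : ζ ≠ -1) :
    ∃ w : ℤ → ℤ, ∀ n m : ℤ,
      m * w n = lawPow k n.natAbs + lawPow k m.natAbs - lawPow k (n + m).natAbs := by
  have hFζ : F ζ ≠ 0 := F_ne_zero_of_unit h hq1 hζ1 hζp hζm
  have hζ0 : ζ ≠ 0 := ne_zero_of_norm_eq_one hζ1
  obtain ⟨_, c, w, hc, hF⟩ := h
  refine ⟨w, fun n m => ?_⟩
  have hqm0 : q2 ^ m * ζ ≠ 0 := mul_ne_zero (zpow_ne_zero m hq0) hζ0
  have e1 := hF (n + m) ζ hζ0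
  have e2 := hF n (q2 ^ m * ζ) hqm0
  rw [hF m ζ hζ0] at e2
  have hsplit : q2 ^ (n + m) * ζ = q2 ^ n * (q2 ^ m * ζ) := by rw [zpow_add₀ hq0, mul_assoc]
  rw [hsplit, e2] at e1
  -- take norms
  have hnorm := congrArg norm e1
  have hq : 0 < ‖q2‖ := norm_pos_iff.mpr hq0
  have hmζ : ‖(q2 ^ m * ζ) ^ w n‖ = ‖q2‖ ^ (m * w n) := by
    rw [norm_zpow, norm_mul, norm_zpow, hζ1, mul_one, zpow_mul]
  simp only [norm_mul, hmζ, hc, norm_zpow, hζ1, one_zpow, mul_one] at hnorm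
  -- hnorm : ‖q2‖^(-L n) * ‖q2‖^(m * w n) * (‖q2‖^(-L m) * ‖F ζ‖) = ‖q2‖^(-L (n+m)) * ‖F ζ‖
  have hFn : ‖F ζ‖ ≠ 0 := norm_ne_zero_iff.mpr hFζ
  have key : ‖q2‖ ^ (-lawPow k n.natAbs + m * w n + -lawPow k m.natAbs) = ‖q2‖ ^ (-lawPow k (n + m).natAbs) := by
    apply mul_right_cancel₀ hFn
    rw [zpow_add₀ hq.ne', zpow_add₀ hq.ne']
    calc ‖q2‖ ^ (-lawPow k n.natAbs) * ‖q2‖ ^ (m * w n) * ‖q2‖ ^ (-lawPow k m.natAbs) * ‖F ζ‖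
        = ‖q2‖ ^ (-lawPow k n.natAbs) * ‖q2‖ ^ (m * w n) * (‖q2‖ ^ (-lawPow k m.natAbs) * ‖F ζ‖) := by ring
      _ = ‖q2‖ ^ (-lawPow k (n + m).natAbs) * ‖F ζ‖ := hnorm
  have hexp := zpow_right_injective₀ hq hq1.ne key
  linarith

/-- **The law is a pure square**: under the hypotheses of `cocycle` (and `1 ≤ k`, so that `L(0) = 0`), `lawPow k m = m²` for every `m : ℕ`. [folklore] -/
theorem lawPow_eq_sq_of_valueLaw (hk : 1 ≤ k) (h : R4_valueLaw k q2 F) (hq0 : q2 ≠ 0) (hq1 : ‖q2‖ < 1) {ζ : 𝕜}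
    (hζ1 : ‖ζ‖ = 1) (hζp : ζ ≠ 1) (hζm : ζ ≠ -1) (m : ℕ) : lawPow k m = (m : ℤ) ^ 2 := by
  obtain ⟨w, hw⟩ := cocycle h hq0 hq1 hζ1 hζp hζm
  have hL0 : lawPow k 0 = 0 := by
    unfold lawPow ceilSqrt
    rw [zero_pow (by omega)]
    simp
  have hL1 : lawPow k 1 = 1 := by
    unfold lawPow
    rw [one_pow, show (1 : ℕ) = 1 ^ 2 from rfl, ceilSqrt_sq]
    rfl
  -- (1, -1): -w 1 = L 1 + L 1 - L 0
  have h1m := hw 1 (-1)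
  have h11 : ((1 : ℤ) + -1).natAbs = 0 := by decide
  rw [h11] at h1m
  simp only [Int.natAbs_one, Int.reduceNeg, Int.natAbs_neg, hL1, hL0] at h1m
  -- h1m : -1 * w 1 = 1 + 1 - 0  ⇒  w 1 = -2
  have hw1 : w 1 = -2 := by linarith
  -- (1, m): m * w 1 = L 1 + L m - L (m+1)  ⇒  L (m+1) = L m + 1 + 2m
  have step : ∀ j : ℕ, lawPow k (j + 1) = lawPow k j + 1 + 2 * (j : ℤ) := by
    intro j
    have := hw 1 (j : ℤ)
    have hn1 : ((1 : ℤ) + (j : ℤ)).natAbs = j + 1 := by omega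
    rw [hw1, hn1, Int.natAbs_one, Int.natAbs_natCast, hL1] at this
    linarith
  induction m with
  | zero => simpa using hL0
  | succ j ih => rw [step j, ih]; push_cast; ring

/-- **`k = 4` IS FORCED**: a value law with a `q̈^ℤ`-factor of automorphy in the sense of `R4_valueLaw k` exists only at the print exponent (`κ′ = 2`). [folklore] -/
theorem eq_four_of_valueLaw (hk : 1 ≤ k) (h : R4_valueLaw k q2 F) (hq0 : q2 ≠ 0) (hq1 : ‖q2‖ < 1) {ζ : 𝕜}
    (hζ1 : ‖ζ‖ = 1) (hζp : ζ ≠ 1) (hζm : ζ ≠ -1) : k = 4 := by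
  have h2 := lawPow_eq_sq_of_valueLaw hk h hq0 hq1 hζ1 hζp hζm 2
  -- lawPow k 2 = 4, i.e. ceilSqrt (2^k) = 4, i.e. 9 < 2^k ≤ 16
  unfold lawPow at h2
  have h4 : ceilSqrt (2 ^ k) = 4 := by exact_mod_cast h2
  have hle : 2 ^ k ≤ 16 := by have := le_ceilSqrt_sq (2 ^ k); rw [h4] at this; simpa using this
  have hgt : ¬ 2 ^ k ≤ 9 := by
    intro h9
    have := ceilSqrt_le_of_le_sq (s := 3) (by simpa using h9)
    omega
  -- 2^k ≤ 16 ⇒ k ≤ 4; 2^k > 9 ⇒ k ≥ 4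
  have hk4 : k ≤ 4 := by
    by_contra hc
    have : 2 ^ 5 ≤ 2 ^ k := Nat.pow_le_pow_right (by norm_num) (by omega)
    omega
  interval_cases k <;> simp_all

/-- **κ′ = 1 (doors O-01…O-03) has NO value-level theta-type object**: `¬ R4_valueLaw 2 q̈ F`. Witness pair `(1,1)`/`(1,−1)`: `w_1 = 0` and `w_1 = −2`. [folklore] -/
theorem not_valueLaw_two (hq0 : q2 ≠ 0) (hq1 : ‖q2‖ < 1) {ζ : 𝕜} (hζ1 : ‖ζ‖ = 1) (hζp : ζ ≠ 1) (hζm : ζ ≠ -1)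
    (F : 𝕜 → 𝕜) : ¬ R4_valueLaw 2 q2 F :=
  fun h => absurd (eq_four_of_valueLaw (by norm_num) h hq0 hq1 hζ1 hζp hζm) (by norm_num)

/-- **κ′ = 3/2 (doors O-04, O-05) has NO value-level theta-type object**: `¬ R4_valueLaw 3 q̈ F`. Witness pair `(1,1)`/`(1,3)`: `w_1 = −1` and
`3·w_1 = ⌈1⌉ + ⌈√27⌉ − ⌈√64⌉ = 1 + 6 − 8 = −1`. [folklore] -/
theorem not_valueLaw_three (hq0 : q2 ≠ 0) (hq1 : ‖q2‖ < 1) {ζ : 𝕜} (hζ1 : ‖ζ‖ = 1) (hζp : ζ ≠ 1) (hζm : ζ ≠ -1)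
    (F : 𝕜 → 𝕜) : ¬ R4_valueLaw 3 q2 F :=
  fun h => absurd (eq_four_of_valueLaw (by norm_num) h hq0 hq1 hζ1 hζp hζm) (by norm_num)

/-- κ′ = 5/2 (REQB k1 row, not a live door) likewise: `¬ R4_valueLaw 5 q̈ F`. [folklore] -/
theorem not_valueLaw_five (hq0 : q2 ≠ 0) (hq1 : ‖q2‖ < 1) {ζ : 𝕜} (hζ1 : ‖ζ‖ = 1) (hζp : ζ ≠ 1) (hζm : ζ ≠ -1)
    (F : 𝕜 → 𝕜) : ¬ R4_valueLaw 5 q2 F :=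
  fun h => absurd (eq_four_of_valueLaw (by norm_num) h hq0 hq1 hζ1 hζp hζm) (by norm_num)

/-- **Non-vacuity of the hypotheses (the print object passes)**: at `k = 4` the automorphy clause IS met by `Θ̈` (p534392 calibration, by name) — so the
obstruction is the exponent, not the frame. [folklore] -/
theorem valueLaw_four_automorphy_inhabited (hq0 : q2 ≠ 0) :
    ∃ (c : ℤ → 𝕜) (w : ℤ → ℤ), (∀ n : ℤ, ‖c n‖ = ‖q2‖ ^ (-(lawPow 4 n.natAbs))) ∧
      ∀ (n : ℤ) (U : 𝕜), U ≠ 0 →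
        Literature.AnabelianGeometry.EtaleTheta.thetaDdot q2 (q2 ^ n * U) =
          c n * U ^ (w n) * Literature.AnabelianGeometry.EtaleTheta.thetaDdot q2 U :=
  R4_valueLaw_four_automorphy_thetaDdot hq0

end Summit.ABC.IUTFork.Repair.RH.AxisCK1ValueLawNoGo

end
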